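import Summits.Ventures.Crystal3D.Theorems.StickyWulffConstantCoaxialWallLawPayerTransCellGenericTwoPlate
import Summits.Ventures.Crystal3D.Theorems.StickyWulffConstantCoaxialWallLawPayerTransMulti
import HarnessLib

/-!
# End accounting, census-free, multi-source VIII: the TWO-PLATE generic translation law — charge φ₁/39

HONEST FRAMING. Part of the venture `Summits/Ventures/Crystal3D` (cell `crystal3d-full`), helper for the crux
`CoaxialWallLaw` (stmt-Ventures-19481) of `route-Ventures-StickyWulffConstant`, REGISTERED line `WallLedgerF`
(planner cf-p1), open stub `stub_coaxialTwoSlabAdhesion` (general fillings).  Rung credit only; F-C1 not moved.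
Memo HOME/wall-19481-p2/F-NEXT-SPEC.md §S1 (19481-p2 g4), planner (xxv) two-plate charging.  The text of
`translate_twoSlabAdhesion_generic_multi` (`…PayerTransMulti`, one plate, charge `φ₁/78`) with the two-plate cell
`wordNet_trans_payers_ge_generic_twoPlate` (`…PayerTransCellGenericTwoPlate`): the rising words of BOTH plates are poured
into the one family-blind capacity (end pairs disjoint by the 3-adic invariants alone), so the full bond flux `2φ₁` is
charged twice (`φ₂ = φ₁` for a translation pair, stated in the bottom frame):

* **`translate_twoSlabAdhesion_generic_twoPlate`** — the stub's inequality for every GENERIC-offset translation pair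
  (`3^k A₁⁻¹(t₂ − t₁) ∉ Λ₀`), arbitrary fillings, charge `φ₁/39 ≥ √3/39 ≈ 4.4·10⁻²` ORIENTATION-FREE, modulo
  `KissingGap δ`, `KissingClassification δ` ONLY (×2 over `φ₁/78`).

WHAT THIS IS NOT: not the stub; the plane-coset translation class is untouched (`1/156`); F-C1 not moved.
-/

noncomputable section

namespace Summit.Ventures.Crystal3D.Theorems

open Summit.Ventures.Crystal3D Finset
open Literature.MathematicalPhysics.StatisticalMechanics (fccStacking contactDeficiency)
open scoped InnerProductSpace

section CensusFree

variable {δ : ℝ} (hg : KissingGap δ) (hc : KissingClassification δ)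
include hg hc

open scoped Classical in
/-- **The census-free TWO-PLATE rung for TRANSLATION pairs with a 3-adically generic offset**: charge `φ₁/39`,
orientation-free, modulo `KissingGap δ`, `KissingClassification δ` only.  See the module docstring. -/
theorem translate_twoSlabAdhesion_generic_twoPlate
    (A₁ : EuclideanSpace ℝ (Fin 3) ≃ₗᵢ[ℝ] EuclideanSpace ℝ (Fin 3)) (t₁ : EuclideanSpace ℝ (Fin 3))
    (A₂ : EuclideanSpace ℝ (Fin 3) ≃ₗᵢ[ℝ] EuclideanSpace ℝ (Fin 3)) (t₂ : EuclideanSpace ℝ (Fin 3))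
    (htrans : A₁ '' fccStacking 1 (Real.sqrt (2 / 3)) = A₂ '' fccStacking 1 (Real.sqrt (2 / 3)))
    (hgen : ∀ k : ℕ, ((3 : ℝ) ^ k) • A₁.symm (t₂ - t₁) ∉ fccStacking 1 (Real.sqrt (2 / 3))) :
    ∃ C R₀ : ℝ, 1 ≤ R₀ ∧ ∀ h : ℝ, 0 ≤ h → ∀ ρ : ℝ, R₀ ≤ ρ →
      ∀ X P₁ P₂ : Finset (EuclideanSpace ℝ (Fin 3)),
      (∀ p ∈ X, ∀ q ∈ X, p ≠ q → 1 ≤ dist p q) → P₁ ⊆ X → P₂ ⊆ X \ P₁ →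
      (∀ p ∈ X, -(2 * R₀) ≤ p 2 ∧ p 2 ≤ h + 2 * R₀ ∧ p 0 ^ 2 + p 1 ^ 2 ≤ ρ ^ 2) →
      (∀ p, p ∈ P₁ ↔ (p ∈ (fun q => A₁ q + t₁) '' fccStacking 1 (Real.sqrt (2 / 3)) ∧
        -(2 * R₀) ≤ p 2 ∧ p 2 ≤ -R₀ ∧ p 0 ^ 2 + p 1 ^ 2 ≤ ρ ^ 2)) →
      (∀ p, p ∈ P₂ ↔ (p ∈ (fun q => A₂ q + t₂) '' fccStacking 1 (Real.sqrt (2 / 3)) ∧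
        h + R₀ ≤ p 2 ∧ p 2 ≤ h + 2 * R₀ ∧ p 0 ^ 2 + p 1 ^ 2 ≤ ρ ^ 2)) →
      ((((P₁ ×ˢ (X \ P₁)).filter fun pq => dist pq.1 pq.2 = 1).card : ℕ) : ℝ) +
        ((((P₂ ×ˢ ((X \ P₁) \ P₂)).filter fun pq => dist pq.1 pq.2 = 1).card : ℕ) : ℝ) ≤
        contactDeficiency ((X \ P₁) \ P₂) +
          (Real.sqrt 2 / 4 * ∑ᶠ w ∈ {w ∈ fccStacking 1 (Real.sqrt (2 / 3)) | ‖w‖ = 1},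
              |⟪w, A₁.symm (EuclideanSpace.single (2 : Fin 3) (1 : ℝ))⟫_ℝ| +
            Real.sqrt 2 / 4 * ∑ᶠ w ∈ {w ∈ fccStacking 1 (Real.sqrt (2 / 3)) | ‖w‖ = 1},
              |⟪w, A₂.symm (EuclideanSpace.single (2 : Fin 3) (1 : ℝ))⟫_ℝ| -
            (Real.sqrt 2 / 4 * ∑ᶠ w ∈ {w ∈ fccStacking 1 (Real.sqrt (2 / 3)) | ‖w‖ = 1},
              |⟪w, A₁.symm (EuclideanSpace.single (2 : Fin 3) (1 : ℝ))⟫_ℝ|) / 39) * Real.pi * ρ ^ 2 +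
          C * (1 + h) * ρ := by
  set φ₁ : ℝ := Real.sqrt 2 / 4 * ∑ᶠ w ∈ {w ∈ fccStacking 1 (Real.sqrt (2 / 3)) | ‖w‖ = 1},
      |⟪w, A₁.symm (EuclideanSpace.single (2 : Fin 3) (1 : ℝ))⟫_ℝ| with hφ₁
  -- the top grain in the bottom frame
  have hΛ₂ : (fun q => A₂ q + t₂) '' fccStacking 1 (Real.sqrt (2 / 3)) =
      (fun q => A₁ q + t₂) '' fccStacking 1 (Real.sqrt (2 / 3)) := by
    have e2 : (fun q => A₂ q + t₂) '' fccStacking 1 (Real.sqrt (2 / 3)) =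
        (fun y => y + t₂) '' (A₂ '' fccStacking 1 (Real.sqrt (2 / 3))) := by rw [Set.image_image]
    have e1 : (fun q => A₁ q + t₂) '' fccStacking 1 (Real.sqrt (2 / 3)) =
        (fun y => y + t₂) '' (A₁ '' fccStacking 1 (Real.sqrt (2 / 3))) := by rw [Set.image_image]
    rw [e2, e1, htrans]
  -- genericity in the cell's form
  have hgen' : ∀ k : ℕ, ∀ q ∈ fccStacking 1 (Real.sqrt (2 / 3)), ((3 : ℝ) ^ k) • (t₂ - t₁) ≠ A₁ q := by
    intro k q hq heq
    apply hgen k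
    have : ((3 : ℝ) ^ k) • A₁.symm (t₂ - t₁) = q := by
      apply A₁.injective
      rw [LinearIsometryEquiv.map_smul, A₁.apply_symm_apply, heq]
    rw [this]; exact hq
  -- the flux of all rising slots is `2 φ₁`
  have hflux : Real.sqrt 2 * ∑ r ∈ fccSlots.filter (fun r => 0 < (A₁ r) 2), (A₁ r) 2 = 2 * φ₁ :=
    sqrt_two_mul_sum_rising_eq_two_phi A₁
  set K : ℝ := 12 * (12 * Real.sqrt 2 * Real.pi + 36 * 10 + 55440) with hK
  have hK0 : 0 ≤ K := by positivity
  obtain ⟨C, hC⟩ := twoSlab_cross_le_of_payers A₁ t₁ A₂ t₂ 10 le_rfl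
  have hK24 : 24 * (12 * Real.sqrt 2 * Real.pi + 36 * 10 + 55440) = 2 * K := by rw [hK]; ring
  refine ⟨C + 2 * K / 78 / 2, 10, by norm_num, ?_⟩
  intro h hh ρ hρ X P₁ P₂ hX hP₁X hP₂X₁ hcyl hP₁ hP₂
  have hP₂X : P₂ ⊆ X := hP₂X₁.trans sdiff_subset
  have hρ0 : (0 : ℝ) ≤ ρ := by linarith
  have hP₂' : ∀ p, p ∈ P₂ ↔ (p ∈ (fun q => A₁ q + t₂) '' fccStacking 1 (Real.sqrt (2 / 3)) ∧
      h + 10 ≤ p 2 ∧ p 2 ≤ h + 2 * 10 ∧ p 0 ^ 2 + p 1 ^ 2 ≤ ρ ^ 2) := by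
    intro p; rw [hP₂, hΛ₂]
  have hcell := wordNet_trans_payers_ge_generic_twoPlate hg hc A₁ t₁ t₂ X P₁ P₂ 10 h ρ le_rfl hh hρ
    hX hcyl hP₁X hP₂X hP₁ hP₂' hgen'
  rw [hflux, hK24] at hcell
  have hpay : 4 * φ₁ / 78 * Real.pi * ρ ^ 2 - 2 * K / 78 * (1 + h) * ρ ≤
      ((X.filter fun z => (X.filter fun q => dist z q = 1).card ≤ 11 ∧
        -(10 : ℝ) - 2 ≤ z 2 ∧ z 2 ≤ h + 10 + 2).card : ℝ) := by
    have hKh : 2 * K * ρ ≤ 2 * K * (1 + h) * ρ := by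
      have := mul_nonneg (mul_nonneg hK0 hh) hρ0; linarith only [this]
    have e : 4 * φ₁ / 78 * Real.pi * ρ ^ 2 - 2 * K / 78 * (1 + h) * ρ =
        (2 * (2 * φ₁ * Real.pi * ρ ^ 2) - 2 * K * (1 + h) * ρ) / 78 := by ring
    rw [e, div_le_iff₀ (by norm_num : (0 : ℝ) < 78)]
    linarith only [hcell, hKh]
  have key := hC h hh ρ hρ X P₁ P₂ hX hP₁X hP₂X₁ hcyl hP₁ hP₂ (4 * φ₁ / 78) (2 * K / 78) (by positivity) hpay
  have e : (4 * φ₁ / 78 : ℝ) / 2 = φ₁ / 39 := by ring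
  rw [e] at key
  exact key

end CensusFree

end Summit.Ventures.Crystal3D.Theorems

end
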